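import Literature.NumberTheory.Automorphic.UnitaryGroupHyperbolicBorelSlice
import Literature.NumberTheory.Automorphic.UnitaryGroupKernelFiniteSum
import HarnessLib

/-!
# `k^T_𝔬(x) = Σ_{γ′ ∈ 𝔬} f(x⁻¹γ′x)·(1 − n_T(γ′, x)) − R_T(x)`: the truncated class kernel regrouped by the
# number of cut-off rational Borels through `γ′`; for a regular hyperbolic class, Arthur's `j`-kernel
(Arthur, *A trace formula for reductive groups I*, Duke Math. J. 45 (1978), §8 — the modified kernel
`j_𝔬^T`, the regrouping of `K_{P,𝔬}(δx, δx)` by the element `δ⁻¹γδ ∈ 𝔬`; Rogawski, *Automorphic Representations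
of Unitary Groups in Three Variables* (1990), §2.2 p. 13 (`k^T_𝔬`, `K_{B,𝔬}`, `j_{P,𝔬}`), §6.1 pp. 79–81
((6.1.1)–(6.1.3): the weight `2T − H(g) − H(wg)` of the hyperbolic term).)

Topic `NumberTheory/Automorphic`; namespace `Literature.NumberTheory.Automorphic.UnitaryGroup`. THEOREMS ONLY over
accepted tree modules: no definition, no named fact, no instance, no notation, no `sorry`. Item (L5-ii) W2-a (second
half) of the T1-qs road (LAW 5 (ii)) of `Cruxes/H413/Lines/F0_T1InnerFormTraceIdentity.lean` (cell
`pub/hodgecm-mathlib`, crux H413). Letters: ★ `kernelClass` (`K_𝔬`), ★ `borelSumClass`, ★ `kernelBorelClass`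
(`K_{B,𝔬}`), ★ `kernelBorelTailClass`, ★ `truncatedKernelClass` (`k^T_𝔬`), ★ `pseudoEisenstein` (`Σ_{q ∈ B(F)∖G(F)}`,
representatives `q.out`), ★ `borelHeight` (`H`), ★ `finite_setOf_lt_borelHeight` (the finite set
`S_T(x) = {q : T < H(q̃x)}`). No measure on `G` is used: everything is pointwise in `x`.

* §1 `support_kernelBorelTailClass_translate_subset`, **`truncatedKernelClass_eq_kernelClass_sub_sum`**:
  `k^T_𝔬(x) = K_𝔬(x,x) − Σ_{q ∈ S_T(x)} K_{B,𝔬}(q̃x, q̃x)` (finite sum; class twin of ★ `truncatedKernel_eq_sub_sum`).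
* §2 **`borelSumClass_translate_eq_tsum_ite`** — `Σ_{β ∈ B(F)∩𝔬} f((δx)⁻¹β(δx)) = Σ'_{γ′ ∈ 𝔬} [δγ′δ⁻¹ ∈ B(F)]·f(x⁻¹γ′x)`
  for a conjugation-invariant class map (the bijection `β ↦ δ⁻¹βδ`).
* §3 **`truncatedKernelClass_eq_tsum_mul_one_sub_count_sub_sum`** (ANY conjugation-invariant class, compactly
  supported `f`, `T > 0`):
  `k^T_𝔬(x) = Σ'_{γ′ ∈ 𝔬} f(x⁻¹γ′x)·(1 − n_T(γ′,x)) − Σ_{q ∈ S_T(x)} D_𝔬(q̃x)` with the BOREL COUNT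
  `n_T(γ′,x) = Σ_{q ∈ S_T(x)} [q̃γ′q̃⁻¹ ∈ B(F)]` and the remainder terms
  `D_𝔬(y) = K_{B,𝔬}(y,y) − Σ_{β ∈ B(F)∩𝔬} f(y⁻¹βy)` («adelic `N`-average minus lattice sum», whose integral
  vanishes — sequel (W2-b)).
* §4 `borelHeight_arithmeticBorel_mul`, `borelHeight_out_mk_mul` (`H(⟦δ⟧.out x) = H(δx)`),
  **`count_eq_ite_add_ite_of_hyperbolic`** — for `γ′ = δ⁻¹γ♯δ` in a REGULAR HYPERBOLIC class,
  `n_T(γ′,x) = 1_{T<H(δx)} + 1_{T<H(w♯δx)}` (★ `out_conj_mem_arithmeticBorel_iff_of_hyperbolic`: exactly the two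
  Borels `B^δ`, `B^{w♯δ}`), and **`truncatedKernelClass_eq_tsum_mul_weight_sub_sum_of_hyperbolic`** — Arthur's
  `j`-kernel: `k^T_𝔬(x) = Σ'_{γ′ ∈ 𝔬} f(x⁻¹γ′x)·(1 − 1_{T<H(δ_{γ′}x)} − 1_{T<H(w♯δ_{γ′}x)}) − R_T(x)` for any section
  `γ′ ↦ δ_{γ′}` with `δ_{γ′}⁻¹γ♯δ_{γ′} = γ′` (★ `exists_conj_eq_mk_toAdelic_of_hyperbolic` provides one for
  `cl = charpoly ∘ adelicVal`).

What is NOT here: `∫ R_T dμ = 0` (W2-b), the unfolding of the `j`-kernel over `T(F)∖G(𝔸)` (W2-c), the rank-one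
interval (W3); the weight here is spelled with `ite`s — equal to the road's `uT` spelling
`(1 : ℝ) − {T<H}.indicator 1 y − {T<H}.indicator 1 (ι w * y)` after `Complex.ofReal`.

## References

* J. Arthur, *A trace formula for reductive groups I: terms associated to classes in `G(ℚ)`*, Duke Math. J. 45
  (1978), §8 [Arthur1978TraceFormulaI].
* J. D. Rogawski, *Automorphic Representations of Unitary Groups in Three Variables*, Annals of Mathematics
  Studies 123 (1990), §2.2 (p. 13), §6.1 (pp. 79–81) [Rogawski1990].
-/

set_option autoImplicit false

noncomputable section

open MeasureTheory Measure NumberField IsDedekindDomain Set Matrix Polynomial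
open scoped NNReal ENNReal Classical MatrixGroups

namespace Literature.NumberTheory.Automorphic

namespace UnitaryGroup

variable {F E : Type} [Field F] [NumberField F] [Field E] [NumberField E] [Algebra F E]
  {c : E ≃ₐ[F] E} {ι : Type*}

/-! ## §1 `k^T_𝔬(x) = K_𝔬(x,x) − Σ_{q ∈ S_T(x)} K_{B,𝔬}(q̃x, q̃x)` as a finite sum (class version of ★ `truncatedKernel_eq_sub_sum`) -/

section FiniteSum

variable [MeasurableSpace (adelicUnipotent F E c 3)]

/-- The class tail has support inside the finite set `S_T(x) = {q : T < H(q̃ x)}` (★ `finite_setOf_lt_borelHeight`).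
[cite: Rogawski1990, §2.2 (p. 13)] -/
theorem support_kernelBorelTailClass_translate_subset (ν : Measure (adelicUnipotent F E c 3))
    (𝓕 : Set (adelicUnipotent F E c 3)) (T : ℝ≥0) (cl : (quasiSplit F E c 3).arithmeticSubgroup → ι) (i : ι)
    (f : (quasiSplit F E c 3).Adelic → ℂ) (x : (quasiSplit F E c 3).Adelic) :
    (Function.support fun q : Quotient (QuotientGroup.rightRel (arithmeticBorel F E c 3)) =>
      kernelBorelTailClass ν 𝓕 T cl i f
        (((q.out : (quasiSplit F E c 3).arithmeticSubgroup) : (quasiSplit F E c 3).Adelic) * x)) ⊆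
      {q | T < borelHeight (((q.out : (quasiSplit F E c 3).arithmeticSubgroup) : (quasiSplit F E c 3).Adelic) * x)} := by
  intro q hq
  by_contra hlt
  exact hq (kernelBorelTailClass_of_not_lt cl i f hlt)

/-- **`k^T_𝔬(x) = K_𝔬(x, x) − Σ_{q ∈ S_T(x)} K_{B,𝔬}(q̃x, q̃x)`**, a genuine finite sum over
`S_T(x) = {q ∈ B(F)∖G(F) : T < H(q̃x)}` (finite by ★ `finite_setOf_lt_borelHeight`), `T > 0`.
[cite: Rogawski1990, §2.2 (p. 13)] -/
theorem truncatedKernelClass_eq_kernelClass_sub_sum (ν : Measure (adelicUnipotent F E c 3))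
    (𝓕 : Set (adelicUnipotent F E c 3)) {T : ℝ≥0} (hT : 0 < T) (cl : (quasiSplit F E c 3).arithmeticSubgroup → ι) (i : ι)
    (f : (quasiSplit F E c 3).Adelic → ℂ) (x : (quasiSplit F E c 3).Adelic) :
    truncatedKernelClass ν 𝓕 T cl i f x = kernelClass cl i f x x -
      ∑ q ∈ (finite_setOf_lt_borelHeight x hT).toFinset,
        kernelBorelClass ν 𝓕 cl i f
          (((q.out : (quasiSplit F E c 3).arithmeticSubgroup) : (quasiSplit F E c 3).Adelic) * x)
          (((q.out : (quasiSplit F E c 3).arithmeticSubgroup) : (quasiSplit F E c 3).Adelic) * x) := by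
  have hsub : (Function.support fun q : Quotient (QuotientGroup.rightRel (arithmeticBorel F E c 3)) =>
      kernelBorelTailClass ν 𝓕 T cl i f
        (((q.out : (quasiSplit F E c 3).arithmeticSubgroup) : (quasiSplit F E c 3).Adelic) * x)) ⊆
      ↑(finite_setOf_lt_borelHeight x hT).toFinset := by
    rw [Set.Finite.coe_toFinset]
    exact support_kernelBorelTailClass_translate_subset ν 𝓕 T cl i f x
  rw [truncatedKernelClass_def, pseudoEisenstein_def, finsum_eq_sum_of_support_subset _ hsub]
  congr 1
  refine Finset.sum_congr rfl fun q hq => ?_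
  rw [Set.Finite.mem_toFinset] at hq
  exact kernelBorelTailClass_of_lt cl i f hq

end FiniteSum

/-! ## §2 `Σ_{β ∈ B(F) ∩ 𝔬} f((δx)⁻¹ β (δx)) = Σ_{γ′ ∈ 𝔬, δγ′δ⁻¹ ∈ B(F)} f(x⁻¹ γ′ x)` — reading the class Borel sum on the class -/

section Reindex

/-- **The class Borel sum at a translate, read on the class**: for a conjugation-invariant class map,
`Σ_{β ∈ B(F), cl β = 𝔬} f((δx)⁻¹ β (δx)) = Σ_{γ′ : cl γ′ = 𝔬} [δ γ′ δ⁻¹ ∈ B(F)] · f(x⁻¹ γ′ x)` — the terms of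
`K_{B,𝔬}`'s lattice sum at `δ x` are the elements of the class lying in the rational Borel `δ⁻¹ B(F) δ`
[Arthur 1978 §8: `K_{P,𝔬}(δx, δx)` regrouped by the element `δ⁻¹ γ δ ∈ 𝔬`]. [cite: Arthur1978TraceFormulaI, §8]
[cite: Rogawski1990, §2.2 (p. 13)] -/
theorem borelSumClass_translate_eq_tsum_ite {cl : (quasiSplit F E c 3).arithmeticSubgroup → ι}
    (hcl : IsConjInvariant cl) (i : ι) (f : (quasiSplit F E c 3).Adelic → ℂ)
    (δ : (quasiSplit F E c 3).arithmeticSubgroup) (x : (quasiSplit F E c 3).Adelic) :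
    borelSumClass cl i f ((δ : (quasiSplit F E c 3).Adelic) * x) ((δ : (quasiSplit F E c 3).Adelic) * x) =
      ∑' γ : cl ⁻¹' {i}, if δ * (γ : (quasiSplit F E c 3).arithmeticSubgroup) * δ⁻¹ ∈ arithmeticBorel F E c 3 then
        f (x⁻¹ * ((γ : (quasiSplit F E c 3).arithmeticSubgroup) : (quasiSplit F E c 3).Adelic) * x) else 0 := by
  rw [borelSumClass_def]
  -- the right-hand side as a sum over the subtype `S = {γ′ ∈ 𝔬 : δ γ′ δ⁻¹ ∈ B(F)}`
  set S : Set (cl ⁻¹' {i}) := {γ | δ * (γ : (quasiSplit F E c 3).arithmeticSubgroup) * δ⁻¹ ∈ arithmeticBorel F E c 3}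
    with hS
  have hR : (∑' γ : cl ⁻¹' {i}, if δ * (γ : (quasiSplit F E c 3).arithmeticSubgroup) * δ⁻¹ ∈ arithmeticBorel F E c 3 then
        f (x⁻¹ * ((γ : (quasiSplit F E c 3).arithmeticSubgroup) : (quasiSplit F E c 3).Adelic) * x) else 0) =
      ∑' γ : S, f (x⁻¹ * (((γ : cl ⁻¹' {i}) : (quasiSplit F E c 3).arithmeticSubgroup) : (quasiSplit F E c 3).Adelic) * x) := by
    rw [tsum_subtype S (fun γ : cl ⁻¹' {i} =>
      f (x⁻¹ * ((γ : (quasiSplit F E c 3).arithmeticSubgroup) : (quasiSplit F E c 3).Adelic) * x))]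
    refine tsum_congr fun γ => ?_
    rw [Set.indicator_apply]
    rfl
  rw [hR]
  -- the bijection `β ↦ δ⁻¹ β δ`
  let e : ((fun β : arithmeticBorel F E c 3 => cl β) ⁻¹' {i}) ≃ S :=
    { toFun := fun β => ⟨⟨δ⁻¹ * ((β : arithmeticBorel F E c 3) : (quasiSplit F E c 3).arithmeticSubgroup) * δ, by
          have h := β.2
          simp only [Set.mem_preimage, Set.mem_singleton_iff] at h ⊢
          rw [hcl.apply_inv_mul_mul, h]⟩, by
          change δ * (δ⁻¹ * ((β : arithmeticBorel F E c 3) : (quasiSplit F E c 3).arithmeticSubgroup) * δ) * δ⁻¹ ∈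
            arithmeticBorel F E c 3
          rw [show δ * (δ⁻¹ * ((β : arithmeticBorel F E c 3) : (quasiSplit F E c 3).arithmeticSubgroup) * δ) * δ⁻¹ =
            ((β : arithmeticBorel F E c 3) : (quasiSplit F E c 3).arithmeticSubgroup) by group]
          exact (β : arithmeticBorel F E c 3).2⟩
      invFun := fun γ => ⟨⟨δ * ((γ : cl ⁻¹' {i}) : (quasiSplit F E c 3).arithmeticSubgroup) * δ⁻¹, γ.2⟩, by
          have h := (γ : cl ⁻¹' {i}).2
          simp only [Set.mem_preimage, Set.mem_singleton_iff] at h ⊢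
          change cl (δ * ((γ : cl ⁻¹' {i}) : (quasiSplit F E c 3).arithmeticSubgroup) * δ⁻¹) = i
          rw [hcl, h]⟩
      left_inv := fun β => by
        apply Subtype.ext; apply Subtype.ext
        change δ * (δ⁻¹ * ((β : arithmeticBorel F E c 3) : (quasiSplit F E c 3).arithmeticSubgroup) * δ) * δ⁻¹ = _
        group
      right_inv := fun γ => by
        apply Subtype.ext; apply Subtype.ext
        change δ⁻¹ * (δ * ((γ : cl ⁻¹' {i}) : (quasiSplit F E c 3).arithmeticSubgroup) * δ⁻¹) * δ = _
        group }
  rw [← e.tsum_eq]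
  refine tsum_congr fun β => ?_
  change f ((((δ : (quasiSplit F E c 3).arithmeticSubgroup) : (quasiSplit F E c 3).Adelic) * x)⁻¹ *
      (((β : arithmeticBorel F E c 3) : (quasiSplit F E c 3).arithmeticSubgroup) : (quasiSplit F E c 3).Adelic) *
      (((δ : (quasiSplit F E c 3).arithmeticSubgroup) : (quasiSplit F E c 3).Adelic) * x)) =
    f (x⁻¹ * (((δ⁻¹ * ((β : arithmeticBorel F E c 3) : (quasiSplit F E c 3).arithmeticSubgroup) * δ :
      (quasiSplit F E c 3).arithmeticSubgroup)) : (quasiSplit F E c 3).Adelic) * x)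
  simp only [Subgroup.coe_mul, Subgroup.coe_inv, _root_.mul_inv_rev, mul_assoc]

end Reindex

/-! ## §3 The Borel count `n_T(γ′, x)` and the regrouping of `k^T_𝔬` -/

section Count

variable [MeasurableSpace (adelicUnipotent F E c 3)]

/-- **`k^T_𝔬(x) = Σ_{γ′ ∈ 𝔬} f(x⁻¹γ′x)·(1 − n_T(γ′,x)) − R_T(x)`** for ANY conjugation-invariant class and any
compactly supported `f`, `T > 0`: here `n_T(γ′, x) = #{q ∈ B(F)∖G(F) : T < H(q̃x), q̃ γ′ q̃⁻¹ ∈ B(F)}` counts the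
CUT-OFF RATIONAL BORELS THROUGH `γ′`, and the remainder `R_T(x) = Σ_{q : T<H(q̃x)} [K_{B,𝔬}(q̃x,q̃x) −
Σ_{β ∈ B(F)∩𝔬} f((q̃x)⁻¹β(q̃x))]` is the «adelic `N`-average minus lattice sum» of the class Borel kernel (its
integral over `G(F)∖G(𝔸)` vanishes — sequel (W2-b)). For a regular hyperbolic class `1 − n_T = u_T` is Arthur's
weight (★ `out_conj_mem_arithmeticBorel_iff_of_hyperbolic`: exactly the two Borels `B^δ`, `B^{wδ}`); for the
central class every Borel counts. [cite: Arthur1978TraceFormulaI, §8] [cite: Rogawski1990, §2.2 (p. 13); §6.1 (pp. 79–81)] -/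
theorem truncatedKernelClass_eq_tsum_mul_one_sub_count_sub_sum (ν : Measure (adelicUnipotent F E c 3))
    (𝓕 : Set (adelicUnipotent F E c 3)) {T : ℝ≥0} (hT : 0 < T) {cl : (quasiSplit F E c 3).arithmeticSubgroup → ι}
    (hcl : IsConjInvariant cl) (i : ι) {f : (quasiSplit F E c 3).Adelic → ℂ} (hf : HasCompactSupport f)
    (x : (quasiSplit F E c 3).Adelic) :
    truncatedKernelClass ν 𝓕 T cl i f x =
      (∑' γ : cl ⁻¹' {i},
        f (x⁻¹ * ((γ : (quasiSplit F E c 3).arithmeticSubgroup) : (quasiSplit F E c 3).Adelic) * x) *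
          (1 - ∑ q ∈ (finite_setOf_lt_borelHeight x hT).toFinset,
            if q.out * (γ : (quasiSplit F E c 3).arithmeticSubgroup) * q.out⁻¹ ∈ arithmeticBorel F E c 3 then (1 : ℂ) else 0)) -
      ∑ q ∈ (finite_setOf_lt_borelHeight x hT).toFinset,
        (kernelBorelClass ν 𝓕 cl i f
            (((q.out : (quasiSplit F E c 3).arithmeticSubgroup) : (quasiSplit F E c 3).Adelic) * x)
            (((q.out : (quasiSplit F E c 3).arithmeticSubgroup) : (quasiSplit F E c 3).Adelic) * x) -
          borelSumClass cl i f
            (((q.out : (quasiSplit F E c 3).arithmeticSubgroup) : (quasiSplit F E c 3).Adelic) * x)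
            (((q.out : (quasiSplit F E c 3).arithmeticSubgroup) : (quasiSplit F E c 3).Adelic) * x)) := by
  set ST := (finite_setOf_lt_borelHeight x hT).toFinset with hST
  -- the finitely supported family `γ′ ↦ f(x⁻¹ γ′ x)` on the class
  set g : cl ⁻¹' {i} → ℂ := fun γ =>
    f (x⁻¹ * ((γ : (quasiSplit F E c 3).arithmeticSubgroup) : (quasiSplit F E c 3).Adelic) * x) with hg
  have hgfin : (Function.support g).Finite := by
    have h := finite_support_kernel_term hf x x
    refine (h.preimage (Subtype.val_injective.injOn)).subset fun γ hγ => ?_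
    exact hγ
  have hgsum : Summable g := summable_of_hasFiniteSupport hgfin
  have hgq : ∀ q : Quotient (QuotientGroup.rightRel (arithmeticBorel F E c 3)),
      Summable fun γ : cl ⁻¹' {i} =>
        if q.out * (γ : (quasiSplit F E c 3).arithmeticSubgroup) * q.out⁻¹ ∈ arithmeticBorel F E c 3 then g γ else 0 := by
    intro q
    refine summable_of_hasFiniteSupport (hgfin.subset fun γ hγ => ?_)
    by_contra h0
    have : g γ = 0 := by simpa using h0
    apply hγ
    simp [this]
  -- step 1: the finite sum and the split `K_B = Σ_{B∩𝔬} + D`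
  rw [truncatedKernelClass_eq_kernelClass_sub_sum ν 𝓕 hT cl i f x]
  have hsplit : ∑ q ∈ ST,
      kernelBorelClass ν 𝓕 cl i f
        (((q.out : (quasiSplit F E c 3).arithmeticSubgroup) : (quasiSplit F E c 3).Adelic) * x)
        (((q.out : (quasiSplit F E c 3).arithmeticSubgroup) : (quasiSplit F E c 3).Adelic) * x) =
      (∑ q ∈ ST, borelSumClass cl i f
        (((q.out : (quasiSplit F E c 3).arithmeticSubgroup) : (quasiSplit F E c 3).Adelic) * x)
        (((q.out : (quasiSplit F E c 3).arithmeticSubgroup) : (quasiSplit F E c 3).Adelic) * x)) +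
      ∑ q ∈ ST,
        (kernelBorelClass ν 𝓕 cl i f
            (((q.out : (quasiSplit F E c 3).arithmeticSubgroup) : (quasiSplit F E c 3).Adelic) * x)
            (((q.out : (quasiSplit F E c 3).arithmeticSubgroup) : (quasiSplit F E c 3).Adelic) * x) -
          borelSumClass cl i f
            (((q.out : (quasiSplit F E c 3).arithmeticSubgroup) : (quasiSplit F E c 3).Adelic) * x)
            (((q.out : (quasiSplit F E c 3).arithmeticSubgroup) : (quasiSplit F E c 3).Adelic) * x)) := by
    rw [← Finset.sum_add_distrib]
    refine Finset.sum_congr rfl fun q _ => ?_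
    ring
  rw [hsplit]
  -- step 2: the Borel sums, read on the class and summed over `q`
  have hB : ∑ q ∈ ST, borelSumClass cl i f
        (((q.out : (quasiSplit F E c 3).arithmeticSubgroup) : (quasiSplit F E c 3).Adelic) * x)
        (((q.out : (quasiSplit F E c 3).arithmeticSubgroup) : (quasiSplit F E c 3).Adelic) * x) =
      ∑' γ : cl ⁻¹' {i}, ∑ q ∈ ST,
        if q.out * (γ : (quasiSplit F E c 3).arithmeticSubgroup) * q.out⁻¹ ∈ arithmeticBorel F E c 3 then g γ else 0 := by
    rw [Summable.tsum_finsetSum (fun q _ => hgq q)]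
    refine Finset.sum_congr rfl fun q _ => ?_
    exact borelSumClass_translate_eq_tsum_ite hcl i f q.out x
  rw [hB, kernelClass_def]
  -- step 3: combine the two series over the class
  have hsum2 : Summable fun γ : cl ⁻¹' {i} => ∑ q ∈ ST,
      (if q.out * (γ : (quasiSplit F E c 3).arithmeticSubgroup) * q.out⁻¹ ∈ arithmeticBorel F E c 3 then g γ else 0) :=
    summable_sum fun q _ => hgq q
  have hcomb : (∑' γ : cl ⁻¹' {i}, g γ) - ∑' γ : cl ⁻¹' {i}, ∑ q ∈ ST,
        (if q.out * (γ : (quasiSplit F E c 3).arithmeticSubgroup) * q.out⁻¹ ∈ arithmeticBorel F E c 3 then g γ else 0) =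
      ∑' γ : cl ⁻¹' {i}, g γ * (1 - ∑ q ∈ ST,
        if q.out * (γ : (quasiSplit F E c 3).arithmeticSubgroup) * q.out⁻¹ ∈ arithmeticBorel F E c 3 then (1 : ℂ) else 0) := by
    rw [← hgsum.tsum_sub hsum2]
    refine tsum_congr fun γ => ?_
    rw [mul_sub, mul_one, Finset.mul_sum]
    congr 1
    refine Finset.sum_congr rfl fun q _ => ?_
    split_ifs <;> simp
  rw [← sub_sub, hcomb]

end Count

/-! ## §4 The hyperbolic class: `n_T(δ⁻¹γ♯δ, x) = 1_{T<H(δx)} + 1_{T<H(w♯δx)}` -/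

section Hyperbolic

/-- `H(b y) = H(y)` for `b ∈ B(F) ≤ G(F)` (★ `borelHeight_rational_borel_mul`). [cite: Rogawski1990, §2.2 (p. 13)] -/
theorem borelHeight_arithmeticBorel_mul {b : (quasiSplit F E c 3).arithmeticSubgroup} (hb : b ∈ arithmeticBorel F E c 3)
    (y : (quasiSplit F E c 3).Adelic) :
    borelHeight (((b : (quasiSplit F E c 3).arithmeticSubgroup) : (quasiSplit F E c 3).Adelic) * y) = borelHeight y := by
  obtain ⟨r, hr⟩ := b.2
  have hrB : (quasiSplit F E c 3).toAdelic r ∈ borelAdelic F E c 3 := by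
    rw [hr]; exact (mem_arithmeticBorel_iff b).1 hb
  rw [← hr]
  exact borelHeight_rational_borel_mul r hrB y

/-- `H(⟦δ⟧.out · x) = H(δ x)`: the height at the ★ `pseudoEisenstein` representative of the coset `B(F)δ`.
[cite: Rogawski1990, §2.2 (p. 13)] -/
theorem borelHeight_out_mk_mul (δ : (quasiSplit F E c 3).arithmeticSubgroup) (x : (quasiSplit F E c 3).Adelic) :
    borelHeight ((((Quotient.mk (QuotientGroup.rightRel (arithmeticBorel F E c 3)) δ).out :
        (quasiSplit F E c 3).arithmeticSubgroup) : (quasiSplit F E c 3).Adelic) * x) =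
      borelHeight (((δ : (quasiSplit F E c 3).arithmeticSubgroup) : (quasiSplit F E c 3).Adelic) * x) := by
  set o := (Quotient.mk (QuotientGroup.rightRel (arithmeticBorel F E c 3)) δ).out with ho
  have h : δ * o⁻¹ ∈ arithmeticBorel F E c 3 := by
    have h1 : Quotient.mk (QuotientGroup.rightRel (arithmeticBorel F E c 3)) o =
        Quotient.mk (QuotientGroup.rightRel (arithmeticBorel F E c 3)) δ := Quotient.out_eq _
    exact QuotientGroup.rightRel_apply.1 (Quotient.eq.1 h1)
  have e : (((δ : (quasiSplit F E c 3).arithmeticSubgroup) : (quasiSplit F E c 3).Adelic) * x) =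
      (((δ * o⁻¹ : (quasiSplit F E c 3).arithmeticSubgroup)) : (quasiSplit F E c 3).Adelic) *
        ((((o : (quasiSplit F E c 3).arithmeticSubgroup)) : (quasiSplit F E c 3).Adelic) * x) := by
    simp only [Subgroup.coe_mul, Subgroup.coe_inv, mul_assoc, inv_mul_cancel_left]
  rw [e, borelHeight_arithmeticBorel_mul h]

/-- **THE BOREL COUNT OF A REGULAR HYPERBOLIC ELEMENT**: for `γ′ = δ⁻¹ γ♯ δ`, `γ♯ = ι(d(a,b,(ca)⁻¹))` regular
hyperbolic, `w♯ = ι(w)`: `n_T(γ′, x) = 1_{T<H(δx)} + 1_{T<H(w♯δx)}` — exactly the two rational Borels `B^δ`,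
`B^{w♯δ}` contain `γ′` (★ `out_conj_mem_arithmeticBorel_iff_of_hyperbolic`, ★ `mk_ne_mk_weyl_mul`), so in THM
`truncatedKernelClass_eq_tsum_mul_one_sub_count_sub_sum` the factor `1 − n_T` is Arthur's weight
`1 − τ̂(H(δx) − T) − τ̂(H(wδx) − T)` of the weighted orbital integral [Rogawski1990, §6.1: `W(g) = 2T − H(g) − H(wg)`
after the `A_M`-integration]. [cite: Rogawski1990, §6.1 (pp. 79–81)] [cite: Arthur1978TraceFormulaI, §8] -/
theorem count_eq_ite_add_ite_of_hyperbolic (hc : c * c = 1) {a b : Eˣ} (ha : c (a : E) * (a : E) ≠ 1)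
    (hb : c (b : E) * (b : E) = 1) {g₀ w : (quasiSplit F E c 3).Rational}
    (hg₀ : ((g₀.1 : GL (Fin 3) E) : Matrix (Fin 3) (Fin 3) E) = !![(a : E), 0, 0; 0, b, 0; 0, 0, (c (a : E))⁻¹])
    (hw : ((w.1 : GL (Fin 3) E) : Matrix (Fin 3) (Fin 3) E) = !![(0 : E), 0, 1; 0, 1, 0; 1, 0, 0])
    {T : ℝ≥0} (hT : 0 < T) (δ : (quasiSplit F E c 3).arithmeticSubgroup) (x : (quasiSplit F E c 3).Adelic) :
    (∑ q ∈ (finite_setOf_lt_borelHeight x hT).toFinset,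
      if q.out * (δ⁻¹ * ⟨(quasiSplit F E c 3).toAdelic g₀, g₀, rfl⟩ * δ) * q.out⁻¹ ∈ arithmeticBorel F E c 3 then (1 : ℂ) else 0) =
      (if T < borelHeight (((δ : (quasiSplit F E c 3).arithmeticSubgroup) : (quasiSplit F E c 3).Adelic) * x) then (1 : ℂ) else 0) +
      (if T < borelHeight ((((⟨(quasiSplit F E c 3).toAdelic w, w, rfl⟩ * δ : (quasiSplit F E c 3).arithmeticSubgroup)) :
        (quasiSplit F E c 3).Adelic) * x) then (1 : ℂ) else 0) := by
  set ST := (finite_setOf_lt_borelHeight x hT).toFinset with hST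
  set q₁ := Quotient.mk (QuotientGroup.rightRel (arithmeticBorel F E c 3)) δ with hq₁
  set q₂ := Quotient.mk (QuotientGroup.rightRel (arithmeticBorel F E c 3))
    ((⟨(quasiSplit F E c 3).toAdelic w, w, rfl⟩ : (quasiSplit F E c 3).arithmeticSubgroup) * δ) with hq₂
  have hne : q₁ ≠ q₂ := mk_ne_mk_weyl_mul hw δ
  -- the summand is `[q = q₁] + [q = q₂]`
  have hterm : ∀ q : Quotient (QuotientGroup.rightRel (arithmeticBorel F E c 3)),
      (if q.out * (δ⁻¹ * ⟨(quasiSplit F E c 3).toAdelic g₀, g₀, rfl⟩ * δ) * q.out⁻¹ ∈ arithmeticBorel F E c 3 then (1 : ℂ) else 0) =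
        (if q = q₁ then (1 : ℂ) else 0) + (if q = q₂ then (1 : ℂ) else 0) := by
    intro q
    rw [show (q.out * (δ⁻¹ * ⟨(quasiSplit F E c 3).toAdelic g₀, g₀, rfl⟩ * δ) * q.out⁻¹ ∈ arithmeticBorel F E c 3) ↔
        (q = q₁ ∨ q = q₂) from out_conj_mem_arithmeticBorel_iff_of_hyperbolic hc ha hb hg₀ hw δ q]
    by_cases h1 : q = q₁
    · have h2 : q ≠ q₂ := fun h2 => hne (h1.symm.trans h2)
      simp [h1, hne]
    · by_cases h2 : q = q₂
      · simp [h2, hne.symm]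
      · simp [h1, h2]
  simp_rw [hterm]
  rw [Finset.sum_add_distrib, Finset.sum_ite_eq' ST q₁, Finset.sum_ite_eq' ST q₂]
  -- membership in `S_T(x)` is the cut-off at the representative, i.e. at `δ x` ∕ `w♯ δ x`
  have hm₁ : q₁ ∈ ST ↔ T < borelHeight (((δ : (quasiSplit F E c 3).arithmeticSubgroup) : (quasiSplit F E c 3).Adelic) * x) := by
    rw [hST, Set.Finite.mem_toFinset, Set.mem_setOf_eq, hq₁, borelHeight_out_mk_mul]
  have hm₂ : q₂ ∈ ST ↔ T < borelHeight ((((⟨(quasiSplit F E c 3).toAdelic w, w, rfl⟩ * δ :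
      (quasiSplit F E c 3).arithmeticSubgroup)) : (quasiSplit F E c 3).Adelic) * x) := by
    rw [hST, Set.Finite.mem_toFinset, Set.mem_setOf_eq, hq₂, borelHeight_out_mk_mul]
  rw [if_congr hm₁ rfl rfl, if_congr hm₂ rfl rfl]


/-- **THE `j`-KERNEL OF A REGULAR HYPERBOLIC CLASS**: for a conjugation-invariant class map `cl` whose class `𝔬 = cl⁻¹{i}`
consists of `G(F)`-conjugates of `γ♯ = ι(d(a,b,(ca)⁻¹))` — witnessed by ANY section `sec` with
`(sec γ′)⁻¹ γ♯ (sec γ′) = γ′` (★ `exists_conj_eq_mk_toAdelic_of_hyperbolic` for `cl = charpoly ∘ adelicVal` or its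
Borel refinement) — and compactly supported `f`, `T > 0`:
`k^T_𝔬(x) = Σ'_{γ′ ∈ 𝔬} f(x⁻¹γ′x)·(1 − 1_{T<H(δ_{γ′}x)} − 1_{T<H(w♯δ_{γ′}x)}) − R_T(x)`, `δ_{γ′} = sec γ′` — Arthur's
weighted kernel `Σ_{δ ∈ T(F)∖G(F)} f(x⁻¹δ⁻¹γδx)·[1 − τ̂(H(δx)−T) − τ̂(H(wδx)−T)]` plus the lattice remainder
[Rogawski1990, §6.1 (6.1.1)–(6.1.3); Arthur 1978 §8]. [cite: Rogawski1990, §6.1 (pp. 79–81)] [cite: Arthur1978TraceFormulaI, §8] -/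
theorem truncatedKernelClass_eq_tsum_mul_weight_sub_sum_of_hyperbolic [MeasurableSpace (adelicUnipotent F E c 3)]
    (ν : Measure (adelicUnipotent F E c 3))
    (𝓕 : Set (adelicUnipotent F E c 3)) (hc : c * c = 1) {a b : Eˣ} (ha : c (a : E) * (a : E) ≠ 1)
    (hb : c (b : E) * (b : E) = 1) {g₀ w : (quasiSplit F E c 3).Rational}
    (hg₀ : ((g₀.1 : GL (Fin 3) E) : Matrix (Fin 3) (Fin 3) E) = !![(a : E), 0, 0; 0, b, 0; 0, 0, (c (a : E))⁻¹])
    (hw : ((w.1 : GL (Fin 3) E) : Matrix (Fin 3) (Fin 3) E) = !![(0 : E), 0, 1; 0, 1, 0; 1, 0, 0])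
    {T : ℝ≥0} (hT : 0 < T) {cl : (quasiSplit F E c 3).arithmeticSubgroup → ι} (hcl : IsConjInvariant cl) (i : ι)
    (sec : cl ⁻¹' {i} → (quasiSplit F E c 3).arithmeticSubgroup)
    (hsec : ∀ γ : cl ⁻¹' {i}, (sec γ)⁻¹ * ⟨(quasiSplit F E c 3).toAdelic g₀, g₀, rfl⟩ * sec γ = (γ : (quasiSplit F E c 3).arithmeticSubgroup))
    {f : (quasiSplit F E c 3).Adelic → ℂ} (hf : HasCompactSupport f) (x : (quasiSplit F E c 3).Adelic) :
    truncatedKernelClass ν 𝓕 T cl i f x =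
      (∑' γ : cl ⁻¹' {i},
        f (x⁻¹ * ((γ : (quasiSplit F E c 3).arithmeticSubgroup) : (quasiSplit F E c 3).Adelic) * x) *
          (1 - (if T < borelHeight (((sec γ : (quasiSplit F E c 3).arithmeticSubgroup) : (quasiSplit F E c 3).Adelic) * x)
                  then (1 : ℂ) else 0) -
               (if T < borelHeight ((((⟨(quasiSplit F E c 3).toAdelic w, w, rfl⟩ * sec γ :
                  (quasiSplit F E c 3).arithmeticSubgroup)) : (quasiSplit F E c 3).Adelic) * x) then (1 : ℂ) else 0))) -
      ∑ q ∈ (finite_setOf_lt_borelHeight x hT).toFinset,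
        (kernelBorelClass ν 𝓕 cl i f
            (((q.out : (quasiSplit F E c 3).arithmeticSubgroup) : (quasiSplit F E c 3).Adelic) * x)
            (((q.out : (quasiSplit F E c 3).arithmeticSubgroup) : (quasiSplit F E c 3).Adelic) * x) -
          borelSumClass cl i f
            (((q.out : (quasiSplit F E c 3).arithmeticSubgroup) : (quasiSplit F E c 3).Adelic) * x)
            (((q.out : (quasiSplit F E c 3).arithmeticSubgroup) : (quasiSplit F E c 3).Adelic) * x)) := by
  rw [truncatedKernelClass_eq_tsum_mul_one_sub_count_sub_sum ν 𝓕 hT hcl i hf x]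
  congr 1
  refine tsum_congr fun γ => ?_
  congr 1
  rw [← hsec γ, count_eq_ite_add_ite_of_hyperbolic hc ha hb hg₀ hw hT (sec γ) x]
  ring

end Hyperbolic

end UnitaryGroup

end Literature.NumberTheory.Automorphic
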